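import Mathlib.Algebra.QuadraticAlgebra.NormDeterminant
import Mathlib.NumberTheory.Padics.PadicVal.Basic
import Mathlib.Tactic.NormNum.Prime
import Literature.NumberTheory.NumberFields.SelmerGroupOddClass
import HarnessLib

/-!
# The real quadratic field `ℚ(√7)` for the Broberg rows of the R-W window table: the primes above `2`, `3`, `47` and their valuations

DEFINITION + proof file of the abc-iut cell (D-0079 RESCUE sub-cell R-W, W1 ROW DECISIONS seat abc-iut-W-row-2, gen 3); classical algebraic
number theory only; TAKES NO SIDE on [IUTchIII] Cor. 3.12 or on any author. Arithmetic of `K = ℚ(√7)`, realised as Mathlib's quadratic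
algebra `QuadraticAlgebra ℚ 7 0` (`ω² = 7`) in the style of the tree's `Literature/NumberTheory/QuadraticFields/Sqrt73.lean` (D. A. Marcus,
*Number Fields*, Ch. 3; J. Neukirch, *Algebraic Number Theory*, Ch. I §8), as needed at N. Broberg's `abc`-example over `ℚ(√7)`
(`(8−3√7)²(5−2√7) + (8+3√7)²(3+√7)³(√7−2)¹² = (3√7−4)⁴`; rows «pilotDataOfK:broberg-Q7:7 / :11» of HOME/plan/rescue/R-W/OPEN-10.md, the
last two OPEN rows of the table). Everything is PROVED (theorems, plus the explicit elements as definitions; no named facts):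
* `K`, `sqrt7 = √7` (an algebraic integer, `sqrt7Int : 𝓞 K`), `[K : ℚ] = 2`, `norm_eq : N(z) = re(z)² − 7·im(z)²`;
* the elements of `𝓞 K`: `ϖ₂ = 3 + sqrt7`, `ϖ₂' = 3 − sqrt7` (`2 = ϖ₂ϖ₂'`), `ϖ₃ = 2 + sqrt7`, `ϖ₃' = sqrt7 − 2` (`3 = ϖ₃ϖ₃'`), `ϖ₄₇ = 3sqrt7 − 4`,
  `ϖ₄₇' = 3sqrt7 + 4` (`47 = ϖ₄₇ϖ₄₇'`), the unit `eps = 8 + 3sqrt7` with inverse `eps' = 8 − 3sqrt7`;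
* the principal ideals `(ϖ₂), (ϖ₃), (ϖ₃'), (ϖ₄₇), (ϖ₄₇')` have prime norm, hence are maximal; as finite places `𝔭₂, 𝔭₃, 𝔭₃', 𝔭₄₇, 𝔭₄₇'`,
  with `𝔭₃ ≠ 𝔭₃'`, `𝔭₄₇ ≠ 𝔭₄₇'`; **the primes of `𝓞 K` containing `3` are exactly `𝔭₃, 𝔭₃'`, those containing `47` exactly `𝔭₄₇, 𝔭₄₇'`**;
* **valuations**: `log v(π) = −1` at `v = (π)` and `0` elsewhere for each prime element, `log v(eps) = log v(eps') = 0`, `log v(3) = −1` at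
  `v ∈ {𝔭₃, 𝔭₃'}` and `log 𝔭₄₇(47) = −1` (`3`, `47` UNRAMIFIED there), via the tree's `log_valuation_of_span_eq_pow` — no computation of `𝓞 K`
  or of the class group is needed.
[cite: NeukirchANT1999, Ch. I §8] for the splitting bookkeeping; everything else is explicit arithmetic in `ℤ[√7]` ([folklore]).
-/

noncomputable section

open scoped Classical NumberField

open Module NumberField QuadraticAlgebra IsDedekindDomain IsDedekindDomain.HeightOneSpectrum Ideal

namespace Summit.ABC.IUTFork.Sqrt7

open Literature.NumberTheory.NumberFields

/-! ### The field -/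

/-- `K = ℚ(√7)` as the quadratic algebra `ℚ[ω]/(ω² − 7)`. [folklore] -/
abbrev K : Type := QuadraticAlgebra ℚ 7 0

/-- `7` is not a square in `ℚ`: `v₇(r²)` is even, `v₇(7) = 1`. [folklore] -/
theorem sq_ne (r : ℚ) : r ^ 2 ≠ (7 : ℚ) + 0 * r := by
  rw [zero_mul, add_zero]
  intro h
  have hr : r ≠ 0 := by rintro rfl; norm_num at h
  haveI : Fact (Nat.Prime 7) := ⟨by norm_num⟩
  have h1 := congrArg (padicValRat 7) h
  rw [padicValRat.pow, show (7 : ℚ) = ((7 : ℕ) : ℚ) by norm_num, padicValRat.self (by norm_num)] at h1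
  omega

/-- `K` is a field. [folklore] -/
instance instFact : Fact (∀ r : ℚ, r ^ 2 ≠ (7 : ℚ) + 0 * r) := ⟨sq_ne⟩

/-- `K` is a number field. [folklore] -/
instance instNumberField : NumberField K := NumberField.mk

/-- `[K : ℚ] = 2`. [folklore] -/
theorem finrank_eq_two : finrank ℚ K = 2 := by
  rw [finrank_eq_card_basis (QuadraticAlgebra.basis (7 : ℚ) 0), Fintype.card_fin]

/-- `sqrt7 = √7`. [folklore] -/
def sqrt7 : K := ⟨0, 1⟩

/-- `re sqrt7 = 0`. [folklore] -/
@[simp] theorem sqrt7_re : sqrt7.re = 0 := rfl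
/-- `im sqrt7 = 1`. [folklore] -/
@[simp] theorem sqrt7_im : sqrt7.im = 1 := rfl

/-- `sqrt7 * sqrt7 = 7`. [folklore] -/
theorem sqrt7_mul_sqrt7 : sqrt7 * sqrt7 = 7 := by
  ext <;> simp [sqrt7]

/-- `sqrt7² = 7`. [folklore] -/
theorem sqrt7_sq : sqrt7 ^ 2 = 7 := by rw [sq, sqrt7_mul_sqrt7]

/-- `sqrt7² + 0·sqrt7 + (−7) = 0` with integer coefficients. [folklore] -/
theorem sqrt7_rel : sqrt7 ^ 2 + ((0 : ℤ) : K) * sqrt7 + ((-7 : ℤ) : K) = 0 := by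
  rw [sqrt7_sq]; push_cast; ring

/-- `sqrt7` is an algebraic integer (root of the monic `X² − 7`). [folklore] -/
theorem isIntegral_sqrt7 : IsIntegral ℤ sqrt7 := by
  refine ⟨Polynomial.X ^ 2 + Polynomial.C 0 * Polynomial.X + Polynomial.C (-7), ?_, ?_⟩
  · rw [add_assoc]
    refine (Polynomial.monic_X_pow 2).add_of_left (lt_of_le_of_lt Polynomial.degree_linear_le ?_)
    rw [Polynomial.degree_X_pow]
    norm_num
  · rw [Polynomial.eval₂_add, Polynomial.eval₂_add, Polynomial.eval₂_pow, Polynomial.eval₂_mul,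
      Polynomial.eval₂_C, Polynomial.eval₂_X, Polynomial.eval₂_C, eq_intCast, eq_intCast]
    exact sqrt7_rel

/-- `sqrt7` as an element of `𝓞 K`. [folklore] -/
def sqrt7Int : 𝓞 K := IsIntegralClosure.mk' (𝓞 K) sqrt7 isIntegral_sqrt7

/-- `(sqrt7Int : K) = sqrt7`. [folklore] -/
@[simp] theorem coe_sqrt7Int : ((sqrt7Int : 𝓞 K) : K) = sqrt7 :=
  IsIntegralClosure.algebraMap_mk' (𝓞 K) sqrt7 isIntegral_sqrt7

/-- `sqrt7² = 7` in `𝓞 K`. [folklore] -/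
theorem sqrt7Int_sq : (sqrt7Int : 𝓞 K) ^ 2 = 7 := by
  apply IsFractionRing.injective (𝓞 K) K
  rw [map_pow, map_ofNat]
  show ((sqrt7Int : 𝓞 K) : K) ^ 2 = 7
  rw [coe_sqrt7Int, sqrt7_sq]

/-! ### Norms -/

/-- The field norm of `K/ℚ` is the quadratic-algebra norm. [folklore] -/
theorem algNorm_eq_norm (z : K) : Algebra.norm ℚ z = z.norm := by
  rw [Algebra.norm_apply, ← det_toLinearMap_eq_norm]
  congr 1

/-- The field norm of `K/ℚ` is `re² − 7 im²`. [folklore] -/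
theorem norm_eq (z : K) : Algebra.norm ℚ z = z.re ^ 2 - 7 * z.im ^ 2 := by
  rw [algNorm_eq_norm, norm_def]; ring

/-- The norm of an algebraic integer, computed in `K`. [folklore] -/
theorem norm_int_eq (x : 𝓞 K) :
    (Algebra.norm ℤ x : ℚ) = (x : K).re ^ 2 - 7 * (x : K).im ^ 2 := by
  rw [Algebra.coe_norm_int, norm_eq]

/-- The absolute norm of a principal ideal `(x)`, computed in `K`: if `re(x)² − 7 im(x)² = ± n` then `N((x)) = n`.
[folklore] -/
theorem absNorm_span_eq {x : 𝓞 K} {n : ℕ} (h : ((x : K).re ^ 2 - 7 * (x : K).im ^ 2) ^ 2 = (n : ℚ) ^ 2) :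
    Ideal.absNorm (Ideal.span {x}) = n := by
  rw [Ideal.absNorm_span_singleton]
  have h1 : ((Algebra.norm ℤ x : ℤ) : ℚ) ^ 2 = ((n : ℤ) : ℚ) ^ 2 := by
    rw [norm_int_eq]; exact_mod_cast h
  have h2 : (Algebra.norm ℤ x) ^ 2 = (n : ℤ) ^ 2 := by exact_mod_cast h1
  have h3 := (sq_eq_sq_iff_abs_eq_abs _ _).mp h2
  rw [Int.abs_natCast, Int.abs_eq_natAbs] at h3
  exact_mod_cast h3

/-- A principal ideal of prime norm is maximal. [folklore] -/
theorem span_isMaximal_of_absNorm {x : 𝓞 K} {p : ℕ} (hp : p.Prime)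
    (h : Ideal.absNorm (Ideal.span {x}) = p) : (Ideal.span {x}).IsMaximal := by
  have hprime : (Ideal.span {x}).IsPrime :=
    Ideal.isPrime_of_irreducible_absNorm (by rw [h]; exact hp)
  refine hprime.isMaximal ?_
  intro h0
  rw [h0, Ideal.absNorm_bot] at h
  exact hp.ne_zero h.symm

/-! ### The prime elements above `2`, `3`, `47` and the fundamental unit -/

/-- `ϖ₂ = 3 + √7`, of norm `2`. [folklore] -/
def ϖ₂ : 𝓞 K := 3 + sqrt7Int
/-- `ϖ₂' = 3 − √7`, of norm `2`. [folklore] -/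
def ϖ₂' : 𝓞 K := 3 - sqrt7Int
/-- `ϖ₃ = 2 + √7`, of norm `−3`. [folklore] -/
def ϖ₃ : 𝓞 K := 2 + sqrt7Int
/-- `ϖ₃' = √7 − 2`, of norm `−3`. [folklore] -/
def ϖ₃' : 𝓞 K := sqrt7Int - 2
/-- `ϖ₄₇ = 3√7 − 4`, of norm `−47`. [folklore] -/
def ϖ₄₇ : 𝓞 K := 3 * sqrt7Int - 4
/-- `ϖ₄₇' = 3√7 + 4`, of norm `−47`. [folklore] -/
def ϖ₄₇' : 𝓞 K := 3 * sqrt7Int + 4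
/-- The fundamental unit `eps = 8 + 3√7` (norm `1`). [folklore] -/
def eps : 𝓞 K := 8 + 3 * sqrt7Int
/-- Its inverse `eps' = 8 − 3√7`. [folklore] -/
def eps' : 𝓞 K := 8 - 3 * sqrt7Int

/-- `2 = ϖ₂ ϖ₂'` in `𝓞 K`. [folklore] -/
theorem ϖ₂_mul_ϖ₂' : ϖ₂ * ϖ₂' = 2 := by
  unfold ϖ₂ ϖ₂'; linear_combination (-1 : 𝓞 K) * sqrt7Int_sq
/-- `3 = ϖ₃ ϖ₃'` in `𝓞 K`. [folklore] -/
theorem ϖ₃_mul_ϖ₃' : ϖ₃ * ϖ₃' = 3 := by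
  unfold ϖ₃ ϖ₃'; linear_combination (1 : 𝓞 K) * sqrt7Int_sq
/-- `47 = ϖ₄₇ ϖ₄₇'` in `𝓞 K`. [folklore] -/
theorem ϖ₄₇_mul_ϖ₄₇' : ϖ₄₇ * ϖ₄₇' = 47 := by
  unfold ϖ₄₇ ϖ₄₇'; linear_combination (9 : 𝓞 K) * sqrt7Int_sq
/-- `eps eps' = 1` in `𝓞 K`. [folklore] -/
theorem eps_mul_eps' : eps * eps' = 1 := by
  unfold eps eps'; linear_combination (-9 : 𝓞 K) * sqrt7Int_sq

/-- `eps` is a unit of `𝓞 K`. [folklore] -/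
theorem isUnit_eps : IsUnit eps := IsUnit.of_mul_eq_one eps' eps_mul_eps'
/-- `eps'` is a unit of `𝓞 K`. [folklore] -/
theorem isUnit_eps' : IsUnit eps' := IsUnit.of_mul_eq_one eps (by rw [mul_comm]; exact eps_mul_eps')

/-- `ϖ₂` in `K`. [folklore] -/
@[simp] theorem coe_ϖ₂ : ((ϖ₂ : 𝓞 K) : K) = 3 + sqrt7 := by simp [ϖ₂, map_ofNat]
/-- `ϖ₂'` in `K`. [folklore] -/
@[simp] theorem coe_ϖ₂' : ((ϖ₂' : 𝓞 K) : K) = 3 - sqrt7 := by simp [ϖ₂', map_ofNat]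
/-- `ϖ₃` in `K`. [folklore] -/
@[simp] theorem coe_ϖ₃ : ((ϖ₃ : 𝓞 K) : K) = 2 + sqrt7 := by simp [ϖ₃, map_ofNat]
/-- `ϖ₃'` in `K`. [folklore] -/
@[simp] theorem coe_ϖ₃' : ((ϖ₃' : 𝓞 K) : K) = sqrt7 - 2 := by simp [ϖ₃', map_ofNat]
/-- `ϖ₄₇` in `K`. [folklore] -/
@[simp] theorem coe_ϖ₄₇ : ((ϖ₄₇ : 𝓞 K) : K) = 3 * sqrt7 - 4 := by simp [ϖ₄₇, map_ofNat]
/-- `ϖ₄₇'` in `K`. [folklore] -/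
@[simp] theorem coe_ϖ₄₇' : ((ϖ₄₇' : 𝓞 K) : K) = 3 * sqrt7 + 4 := by simp [ϖ₄₇', map_ofNat]
/-- `eps` in `K`. [folklore] -/
@[simp] theorem coe_eps : ((eps : 𝓞 K) : K) = 8 + 3 * sqrt7 := by simp [eps, map_ofNat]
/-- `eps'` in `K`. [folklore] -/
@[simp] theorem coe_eps' : ((eps' : 𝓞 K) : K) = 8 - 3 * sqrt7 := by simp [eps', map_ofNat]

/-- `N((ϖ₂)) = 2`. [folklore] -/
theorem absNorm_span_ϖ₂ : Ideal.absNorm (Ideal.span {ϖ₂}) = 2 :=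
  absNorm_span_eq (by rw [coe_ϖ₂]; simp [sqrt7]; norm_num)
/-- `N((ϖ₃)) = 3`. [folklore] -/
theorem absNorm_span_ϖ₃ : Ideal.absNorm (Ideal.span {ϖ₃}) = 3 :=
  absNorm_span_eq (by rw [coe_ϖ₃]; simp [sqrt7]; norm_num)
/-- `N((ϖ₃')) = 3`. [folklore] -/
theorem absNorm_span_ϖ₃' : Ideal.absNorm (Ideal.span {ϖ₃'}) = 3 :=
  absNorm_span_eq (by rw [coe_ϖ₃']; simp [sqrt7]; norm_num)
/-- `N((ϖ₄₇)) = 47`. [folklore] -/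
theorem absNorm_span_ϖ₄₇ : Ideal.absNorm (Ideal.span {ϖ₄₇}) = 47 :=
  absNorm_span_eq (by rw [coe_ϖ₄₇]; simp [sqrt7]; norm_num)
/-- `N((ϖ₄₇')) = 47`. [folklore] -/
theorem absNorm_span_ϖ₄₇' : Ideal.absNorm (Ideal.span {ϖ₄₇'}) = 47 :=
  absNorm_span_eq (by rw [coe_ϖ₄₇']; simp [sqrt7]; norm_num)

/-- `(ϖ₂)` is maximal. [folklore] -/
theorem span_ϖ₂_isMaximal : (Ideal.span {ϖ₂}).IsMaximal := span_isMaximal_of_absNorm Nat.prime_two absNorm_span_ϖ₂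
/-- `(ϖ₃)` is maximal. [folklore] -/
theorem span_ϖ₃_isMaximal : (Ideal.span {ϖ₃}).IsMaximal := span_isMaximal_of_absNorm Nat.prime_three absNorm_span_ϖ₃
/-- `(ϖ₃')` is maximal. [folklore] -/
theorem span_ϖ₃'_isMaximal : (Ideal.span {ϖ₃'}).IsMaximal := span_isMaximal_of_absNorm Nat.prime_three absNorm_span_ϖ₃'
/-- `(ϖ₄₇)` is maximal. [folklore] -/
theorem span_ϖ₄₇_isMaximal : (Ideal.span {ϖ₄₇}).IsMaximal :=
  span_isMaximal_of_absNorm (by norm_num) absNorm_span_ϖ₄₇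
/-- `(ϖ₄₇')` is maximal. [folklore] -/
theorem span_ϖ₄₇'_isMaximal : (Ideal.span {ϖ₄₇'}).IsMaximal :=
  span_isMaximal_of_absNorm (by norm_num) absNorm_span_ϖ₄₇'

/-- `ϖ₃, ϖ₃', ϖ₄₇, ϖ₄₇', ϖ₂, eps, eps'` are non-zero in `K` (their `√7`-coordinate is non-zero). [folklore] -/
theorem coe_ne_zero :
    ((ϖ₃ : 𝓞 K) : K) ≠ 0 ∧ ((ϖ₃' : 𝓞 K) : K) ≠ 0 ∧ ((ϖ₄₇ : 𝓞 K) : K) ≠ 0 ∧ ((ϖ₄₇' : 𝓞 K) : K) ≠ 0 ∧ ((ϖ₂ : 𝓞 K) : K) ≠ 0 ∧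
      ((eps : 𝓞 K) : K) ≠ 0 ∧ ((eps' : 𝓞 K) : K) ≠ 0 := by
  refine ⟨?_, ?_, ?_, ?_, ?_, ?_, ?_⟩ <;>
    · intro h
      have := congrArg QuadraticAlgebra.im h
      simp [sqrt7] at this

/-- A maximal principal ideal `(x)`, `x ≠ 0`, as a finite place. [folklore] -/
def placeOfSpan (x : 𝓞 K) (hx : (Ideal.span {x}).IsMaximal) (h0 : (x : K) ≠ 0) : HeightOneSpectrum (𝓞 K) :=
  ⟨Ideal.span {x}, hx.isPrime, by
    rw [Ne, Ideal.span_singleton_eq_bot]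
    exact fun h => h0 (by rw [h]; rfl)⟩

/-- The place `𝔭₂ = (3 + √7)` above `2`. [folklore] -/
def 𝔭₂ : HeightOneSpectrum (𝓞 K) := placeOfSpan ϖ₂ span_ϖ₂_isMaximal coe_ne_zero.2.2.2.2.1
/-- The place `𝔭₃ = (2 + √7)` above `3`. [folklore] -/
def 𝔭₃ : HeightOneSpectrum (𝓞 K) := placeOfSpan ϖ₃ span_ϖ₃_isMaximal coe_ne_zero.1
/-- The place `𝔭₃' = (√7 − 2)` above `3`. [folklore] -/
def 𝔭₃' : HeightOneSpectrum (𝓞 K) := placeOfSpan ϖ₃' span_ϖ₃'_isMaximal coe_ne_zero.2.1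
/-- The place `𝔭₄₇ = (3√7 − 4)` above `47`. [folklore] -/
def 𝔭₄₇ : HeightOneSpectrum (𝓞 K) := placeOfSpan ϖ₄₇ span_ϖ₄₇_isMaximal coe_ne_zero.2.2.1
/-- The place `𝔭₄₇' = (3√7 + 4)` above `47`. [folklore] -/
def 𝔭₄₇' : HeightOneSpectrum (𝓞 K) := placeOfSpan ϖ₄₇' span_ϖ₄₇'_isMaximal coe_ne_zero.2.2.2.1

/-- `𝔭₂.asIdeal = (ϖ₂)`. [folklore] -/
@[simp] theorem 𝔭₂_asIdeal : 𝔭₂.asIdeal = Ideal.span {ϖ₂} := rfl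
/-- `𝔭₃.asIdeal = (ϖ₃)`. [folklore] -/
@[simp] theorem 𝔭₃_asIdeal : 𝔭₃.asIdeal = Ideal.span {ϖ₃} := rfl
/-- `𝔭₃'.asIdeal = (ϖ₃')`. [folklore] -/
@[simp] theorem 𝔭₃'_asIdeal : 𝔭₃'.asIdeal = Ideal.span {ϖ₃'} := rfl
/-- `𝔭₄₇.asIdeal = (ϖ₄₇)`. [folklore] -/
@[simp] theorem 𝔭₄₇_asIdeal : 𝔭₄₇.asIdeal = Ideal.span {ϖ₄₇} := rfl
/-- `𝔭₄₇'.asIdeal = (ϖ₄₇')`. [folklore] -/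
@[simp] theorem 𝔭₄₇'_asIdeal : 𝔭₄₇'.asIdeal = Ideal.span {ϖ₄₇'} := rfl

/-- `3 ∈ 𝔭₃`. [folklore] -/
theorem three_mem_𝔭₃ : (3 : 𝓞 K) ∈ 𝔭₃.asIdeal := by
  rw [𝔭₃_asIdeal, ← ϖ₃_mul_ϖ₃']; exact Ideal.mul_mem_right _ _ (Ideal.mem_span_singleton_self _)
/-- `3 ∈ 𝔭₃'`. [folklore] -/
theorem three_mem_𝔭₃' : (3 : 𝓞 K) ∈ 𝔭₃'.asIdeal := by
  rw [𝔭₃'_asIdeal, ← ϖ₃_mul_ϖ₃']; exact Ideal.mul_mem_left _ _ (Ideal.mem_span_singleton_self _)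
/-- `47 ∈ 𝔭₄₇`. [folklore] -/
theorem fortySeven_mem_𝔭₄₇ : (47 : 𝓞 K) ∈ 𝔭₄₇.asIdeal := by
  rw [𝔭₄₇_asIdeal, ← ϖ₄₇_mul_ϖ₄₇']; exact Ideal.mul_mem_right _ _ (Ideal.mem_span_singleton_self _)
/-- `47 ∈ 𝔭₄₇'`. [folklore] -/
theorem fortySeven_mem_𝔭₄₇' : (47 : 𝓞 K) ∈ 𝔭₄₇'.asIdeal := by
  rw [𝔭₄₇'_asIdeal, ← ϖ₄₇_mul_ϖ₄₇']; exact Ideal.mul_mem_left _ _ (Ideal.mem_span_singleton_self _)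
/-- `2 ∈ 𝔭₂`. [folklore] -/
theorem two_mem_𝔭₂ : (2 : 𝓞 K) ∈ 𝔭₂.asIdeal := by
  rw [𝔭₂_asIdeal, ← ϖ₂_mul_ϖ₂']; exact Ideal.mul_mem_right _ _ (Ideal.mem_span_singleton_self _)

/-- `𝔭₃ ≠ 𝔭₃'` (`ϖ₃ − ϖ₃' = 4` and `3` would both lie in it). [folklore] -/
theorem 𝔭₃_ne_𝔭₃' : 𝔭₃ ≠ 𝔭₃' := by
  intro h
  have h4 : (4 : 𝓞 K) ∈ 𝔭₃.asIdeal := by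
    have h1 : (ϖ₃ : 𝓞 K) ∈ 𝔭₃.asIdeal := Ideal.mem_span_singleton_self _
    have h2 : (ϖ₃' : 𝓞 K) ∈ 𝔭₃.asIdeal := by rw [h]; exact Ideal.mem_span_singleton_self _
    have := Ideal.sub_mem _ h1 h2
    simp only [ϖ₃, ϖ₃'] at this
    convert this using 1; ring
  have h1 : (1 : 𝓞 K) ∈ 𝔭₃.asIdeal := by
    have := Ideal.sub_mem _ h4 three_mem_𝔭₃
    convert this using 1; norm_num
  exact 𝔭₃.isPrime.ne_top ((Ideal.eq_top_iff_one _).mpr h1)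

/-- `𝔭₄₇ ≠ 𝔭₄₇'` (`ϖ₄₇' − ϖ₄₇ = 8` and `47` would both lie in it). [folklore] -/
theorem 𝔭₄₇_ne_𝔭₄₇' : 𝔭₄₇ ≠ 𝔭₄₇' := by
  intro h
  have h8 : (8 : 𝓞 K) ∈ 𝔭₄₇.asIdeal := by
    have h1 : (ϖ₄₇ : 𝓞 K) ∈ 𝔭₄₇.asIdeal := Ideal.mem_span_singleton_self _
    have h2 : (ϖ₄₇' : 𝓞 K) ∈ 𝔭₄₇.asIdeal := by rw [h]; exact Ideal.mem_span_singleton_self _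
    have := Ideal.sub_mem _ h2 h1
    simp only [ϖ₄₇, ϖ₄₇'] at this
    convert this using 1; ring
  have h1 : (1 : 𝓞 K) ∈ 𝔭₄₇.asIdeal := by
    have h48 : (48 : 𝓞 K) ∈ 𝔭₄₇.asIdeal := by
      have := Ideal.mul_mem_left _ (6 : 𝓞 K) h8
      convert this using 1; norm_num
    have := Ideal.sub_mem _ h48 fortySeven_mem_𝔭₄₇
    convert this using 1; norm_num
  exact 𝔭₄₇.isPrime.ne_top ((Ideal.eq_top_iff_one _).mpr h1)

/-! ### The primes containing `3`, `47` -/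

/-- **The primes of `𝓞 K` containing `3` are `𝔭₃` and `𝔭₃'`** (`3 = ϖ₃ϖ₃'` splits). [folklore] -/
theorem eq_of_three_mem (v : HeightOneSpectrum (𝓞 K)) (h3 : (3 : 𝓞 K) ∈ v.asIdeal) : v = 𝔭₃ ∨ v = 𝔭₃' := by
  rw [← ϖ₃_mul_ϖ₃'] at h3
  rcases v.isPrime.mem_or_mem h3 with h | h
  · left
    exact HeightOneSpectrum.ext
      (span_ϖ₃_isMaximal.eq_of_le v.isPrime.ne_top ((Ideal.span_singleton_le_iff_mem _).mpr h)).symm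
  · right
    exact HeightOneSpectrum.ext
      (span_ϖ₃'_isMaximal.eq_of_le v.isPrime.ne_top ((Ideal.span_singleton_le_iff_mem _).mpr h)).symm

/-- **The primes of `𝓞 K` containing `47` are `𝔭₄₇` and `𝔭₄₇'`** (`47 = ϖ₄₇ϖ₄₇'` splits). [folklore] -/
theorem eq_of_fortySeven_mem (v : HeightOneSpectrum (𝓞 K)) (h47 : (47 : 𝓞 K) ∈ v.asIdeal) :
    v = 𝔭₄₇ ∨ v = 𝔭₄₇' := by
  rw [← ϖ₄₇_mul_ϖ₄₇'] at h47
  rcases v.isPrime.mem_or_mem h47 with h | h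
  · left
    exact HeightOneSpectrum.ext
      (span_ϖ₄₇_isMaximal.eq_of_le v.isPrime.ne_top ((Ideal.span_singleton_le_iff_mem _).mpr h)).symm
  · right
    exact HeightOneSpectrum.ext
      (span_ϖ₄₇'_isMaximal.eq_of_le v.isPrime.ne_top ((Ideal.span_singleton_le_iff_mem _).mpr h)).symm

/-! ### Valuations of the prime elements and of the units -/

/-- `log v(ϖ₃) = −1` at `v = 𝔭₃`, `0` elsewhere. [folklore] -/
theorem log_valuation_ϖ₃ (v : HeightOneSpectrum (𝓞 K)) :
    WithZero.log (v.valuation K ((ϖ₃ : 𝓞 K) : K)) = if v = 𝔭₃ then -1 else 0 := by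
  simpa using log_valuation_of_span_eq_pow (P := 𝔭₃) (h := 1) (π := ϖ₃) (by rw [pow_one]; rfl) v
/-- `log v(ϖ₃') = −1` at `v = 𝔭₃'`, `0` elsewhere. [folklore] -/
theorem log_valuation_ϖ₃' (v : HeightOneSpectrum (𝓞 K)) :
    WithZero.log (v.valuation K ((ϖ₃' : 𝓞 K) : K)) = if v = 𝔭₃' then -1 else 0 := by
  simpa using log_valuation_of_span_eq_pow (P := 𝔭₃') (h := 1) (π := ϖ₃') (by rw [pow_one]; rfl) v
/-- `log v(ϖ₄₇) = −1` at `v = 𝔭₄₇`, `0` elsewhere. [folklore] -/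
theorem log_valuation_ϖ₄₇ (v : HeightOneSpectrum (𝓞 K)) :
    WithZero.log (v.valuation K ((ϖ₄₇ : 𝓞 K) : K)) = if v = 𝔭₄₇ then -1 else 0 := by
  simpa using log_valuation_of_span_eq_pow (P := 𝔭₄₇) (h := 1) (π := ϖ₄₇) (by rw [pow_one]; rfl) v
/-- `log v(ϖ₂) = −1` at `v = 𝔭₂`, `0` elsewhere. [folklore] -/
theorem log_valuation_ϖ₂ (v : HeightOneSpectrum (𝓞 K)) :
    WithZero.log (v.valuation K ((ϖ₂ : 𝓞 K) : K)) = if v = 𝔭₂ then -1 else 0 := by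
  simpa using log_valuation_of_span_eq_pow (P := 𝔭₂) (h := 1) (π := ϖ₂) (by rw [pow_one]; rfl) v

/-- A unit has valuation `1` everywhere: `log v(x) = 0`. [folklore] -/
theorem log_valuation_eq_zero_of_isUnit (v : HeightOneSpectrum (𝓞 K)) {x : 𝓞 K} (hx : IsUnit x) :
    WithZero.log (v.valuation K ((x : 𝓞 K) : K)) = 0 :=
  log_valuation_eq_zero_of_not_mem v fun hmem => v.isPrime.ne_top (Ideal.eq_top_of_isUnit_mem _ hmem hx)

/-- `log v(eps) = 0`. [folklore] -/
theorem log_valuation_eps (v : HeightOneSpectrum (𝓞 K)) : WithZero.log (v.valuation K ((eps : 𝓞 K) : K)) = 0 :=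
  log_valuation_eq_zero_of_isUnit v isUnit_eps
/-- `log v(eps') = 0`. [folklore] -/
theorem log_valuation_eps' (v : HeightOneSpectrum (𝓞 K)) : WithZero.log (v.valuation K ((eps' : 𝓞 K) : K)) = 0 :=
  log_valuation_eq_zero_of_isUnit v isUnit_eps'

/-- The valuation of a non-zero algebraic integer is non-zero. [folklore] -/
theorem valuation_ne_zero_of_ne_zero (v : HeightOneSpectrum (𝓞 K)) {x : K} (hx : x ≠ 0) : v.valuation K x ≠ 0 :=
  (v.valuation K).ne_zero_iff.mpr hx

/-- **`3` is unramified at `𝔭₃` and `𝔭₃'`: `log v(3) = −1`** (`3 = ϖ₃ϖ₃'`, `𝔭₃ ≠ 𝔭₃'`). [folklore] -/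
theorem log_valuation_three {v : HeightOneSpectrum (𝓞 K)} (hv : v = 𝔭₃ ∨ v = 𝔭₃') :
    WithZero.log (v.valuation K (3 : K)) = -1 := by
  have h3 : (3 : K) = ((ϖ₃ : 𝓞 K) : K) * ((ϖ₃' : 𝓞 K) : K) := by
    rw [← map_mul, ϖ₃_mul_ϖ₃']; simp [map_ofNat]
  rw [h3, map_mul, WithZero.log_mul (valuation_ne_zero_of_ne_zero v coe_ne_zero.1)
    (valuation_ne_zero_of_ne_zero v coe_ne_zero.2.1), log_valuation_ϖ₃, log_valuation_ϖ₃']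
  rcases hv with rfl | rfl
  · rw [if_pos rfl, if_neg 𝔭₃_ne_𝔭₃']; rfl
  · rw [if_neg 𝔭₃_ne_𝔭₃'.symm, if_pos rfl]; rfl

/-- **`47` is unramified at `𝔭₄₇`: `log v(47) = −1`** (`47 = ϖ₄₇ϖ₄₇'`, `𝔭₄₇ ≠ 𝔭₄₇'`). [folklore] -/
theorem log_valuation_fortySeven : WithZero.log (𝔭₄₇.valuation K (47 : K)) = -1 := by
  have h47 : (47 : K) = ((ϖ₄₇ : 𝓞 K) : K) * ((ϖ₄₇' : 𝓞 K) : K) := by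
    rw [← map_mul, ϖ₄₇_mul_ϖ₄₇']; simp [map_ofNat]
  have h2 : WithZero.log (𝔭₄₇.valuation K ((ϖ₄₇' : 𝓞 K) : K)) = 0 := by
    refine log_valuation_eq_zero_of_not_mem 𝔭₄₇ fun hmem => 𝔭₄₇_ne_𝔭₄₇' ?_
    exact HeightOneSpectrum.ext
      (span_ϖ₄₇'_isMaximal.eq_of_le 𝔭₄₇.isPrime.ne_top ((Ideal.span_singleton_le_iff_mem _).mpr hmem)).symm
  rw [h47, map_mul, WithZero.log_mul (valuation_ne_zero_of_ne_zero 𝔭₄₇ coe_ne_zero.2.2.1)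
    (valuation_ne_zero_of_ne_zero 𝔭₄₇ coe_ne_zero.2.2.2.1), log_valuation_ϖ₄₇, h2, if_pos rfl]
  rfl

end Summit.ABC.IUTFork.Sqrt7

end
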